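import Mathlib.Combinatorics.SetFamily.FourFunctions
import Mathlib.Tactic
import HarnessLib
import HarnessLib.Audit.Tags
import Summits.CriticalPhenomena.PercolationContinuityZ3.Theorems.PercNearOneGluingNoHeavyLowerTailSahiTypeSetDaykinCompress

/-!
# `TypeSetSignedDaykin` holds whenever `∅ ∈ Z` (the `{∅, G}` face of the type-set conjecture)

Support file (seat `prim-masterthm-p1`, gen 43; `--supports stmt-CriticalPhenomena-4575`).  Theorems only; no `sorry`, standard axioms.
Memo `run/shared/lean/prim/prim-masterthm/FROM-prim-masterthm-p1-g43-TYPE-SETS.md` §4, §8.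

THE FACE ([this work]).  Let `(G, Z, L)` be a type-set configuration (`…SahiTypeSetDaykin`: `Z ⊆ 2^G` complement-closed, nonempty equivariant
type-sets) with `∅ ∈ Z` (equivalently `G ∈ Z`).  Then for every member `z`:  `z ∈ typeMeets Z L` or `G \ z ∈ typeMeets Z L`
(`mem_or_compl_mem_typeMeets_of_empty_mem`): pick `t ∈ L z`, `g ∈ L G`; exactly one of `tcompat t g`, `tcompat t (flipT g)` holds
(`tcompat_flipT_right`), giving `z = z ∩ G` compatible, or — flipping both — `G \ z = (G \ z) ∩ G` compatible.  A self-compatible member has BOTH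
`z = z ∩ z` and (its complement being self-compatible too) `G \ z`.  Counting over members (`card_add_card_filter_le_two_mul_card_typeMeets_of_empty_mem`):
**`#Z + #{z : L z self-compatible} ≤ 2 · #typeMeets Z L`**, i.e. the conclusion of `TypeSetSignedDaykin` — for every configuration containing `∅`.
This is the type-set form of `card_le_card_partDiffs_of_empty_mem` (`…SahiPartitionDaykinEmpty`) and the terminal case of every compression sequence
(memo §8: a sequence of GOOD compressions ending in a configuration containing `∅` proves the inequality for the initial configuration, by the slack
identity of `…SahiTypeSetDaykinCompress`).  HONEST FRAMING: a face of an OPEN conjecture. [this work]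
-/

namespace Summit.CriticalPhenomena.PercolationContinuityZ3.Theorems.SahiColouredDaykin

open Finset

variable {α : Type*} [DecidableEq α]

/-- `flipT` is an involution. [this work] -/
theorem flipT_flipT (t : ℕ × Bool) : flipT (flipT t) = t := by
  unfold flipT; simp

/-- Exactly one of `g`, `flipT g` is compatible with a given type `t` — here the direction we need: if `t` is not compatible with `g` then it is
compatible with `flipT g`. [this work] -/
theorem tcompat_flipT_right_of_not {t g : ℕ × Bool} (h : tcompat t g ≠ true) : tcompat t (flipT g) = true := by
  rw [Ne, tcompat_eq_true_iff] at h
  rw [tcompat_eq_true_iff]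
  unfold flipT
  simp only
  constructor
  · intro h1 h2
    apply h
    constructor
    · intro _ h3; rw [h3] at h2; simp at h2
    · intro _; exact h1
  · intro h2
    by_contra h1
    apply h
    constructor
    · intro h3; exact absurd h3 h1
    · intro h3
      exfalso; apply h2
      cases hb : t.2 <;> cases hg : g.2 <;> simp_all

section face

variable {G : Finset α} {Z : Finset (Finset α)} {L : Finset α → Finset (ℕ × Bool)}

/-- In a complement-closed configuration containing `∅`, also `G ∈ Z`. [this work] -/
theorem univ_mem_of_empty_mem (hcc : ∀ z ∈ Z, G \ z ∈ Z) (h0 : (∅ : Finset α) ∈ Z) : G ∈ Z := by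
  have := hcc ∅ h0; rwa [sdiff_empty] at this

/-- **The face, member by member.**  If `∅ ∈ Z` then every member or its complement is a compatible meet. [this work] -/
theorem mem_or_compl_mem_typeMeets_of_empty_mem (hZG : ∀ z ∈ Z, z ⊆ G) (hcc : ∀ z ∈ Z, G \ z ∈ Z)
    (hne : ∀ z ∈ Z, (L z).Nonempty) (hflip : ∀ z ∈ Z, L (G \ z) = (L z).image flipT) (h0 : (∅ : Finset α) ∈ Z)
    {z : Finset α} (hz : z ∈ Z) : z ∈ typeMeets Z L ∨ G \ z ∈ typeMeets Z L := by
  have hG : G ∈ Z := univ_mem_of_empty_mem hcc h0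
  obtain ⟨t, ht⟩ := hne z hz
  obtain ⟨g, hg⟩ := hne G hG
  by_cases h : tcompat t g = true
  · left
    refine mem_typeMeets_iff.2 ⟨z, hz, G, hG, (lcompat_iff _ _).2 ⟨t, ht, g, hg, h⟩, ?_⟩
    exact inter_eq_left.2 (hZG z hz)
  · right
    have h' : tcompat t (flipT g) = true := tcompat_flipT_right_of_not h
    -- flip both: flipT t ∈ L (G \ z), flipT (flipT g) = g ∈ L G
    have hft : flipT t ∈ L (G \ z) := by rw [hflip z hz]; exact mem_image_of_mem _ ht
    have hc : tcompat (flipT t) g = true := by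
      have := tcompat_flipT t (flipT g); rw [flipT_flipT] at this; rw [this]; exact h'
    refine mem_typeMeets_iff.2 ⟨G \ z, hcc z hz, G, hG, (lcompat_iff _ _).2 ⟨flipT t, hft, g, hg, hc⟩, ?_⟩
    exact inter_eq_left.2 sdiff_subset

/-- A self-compatible member is itself a compatible meet. [this work] -/
theorem mem_typeMeets_of_selfcompat {z : Finset α} (hz : z ∈ Z) (hsc : lcompat (L z) (L z) = true) : z ∈ typeMeets Z L :=
  mem_typeMeets_iff.2 ⟨z, hz, z, hz, hsc, inter_self z⟩

/-- Self-compatibility is preserved by complementation. [this work] -/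
theorem selfcompat_compl (hflip : ∀ z ∈ Z, L (G \ z) = (L z).image flipT) {z : Finset α} (hz : z ∈ Z)
    (hsc : lcompat (L z) (L z) = true) : lcompat (L (G \ z)) (L (G \ z)) = true := by
  rw [hflip z hz, lcompat_image_flipT]; exact hsc

/-- **`TypeSetSignedDaykin` on the face `∅ ∈ Z`.**  The map `z ↦ (z if z ∈ typeMeets else G \ z)` sends `Z` into `typeMeets` with fibres of size
`≤ 2`, and is injective on the self-compatible members (which are all sent to themselves); counting gives
`#Z + #{z ∈ Z : self-compatible} ≤ 2 · #typeMeets Z L`. [this work] -/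
theorem card_add_card_filter_le_two_mul_card_typeMeets_of_empty_mem (hZG : ∀ z ∈ Z, z ⊆ G) (hcc : ∀ z ∈ Z, G \ z ∈ Z)
    (hne : ∀ z ∈ Z, (L z).Nonempty) (hflip : ∀ z ∈ Z, L (G \ z) = (L z).image flipT) (h0 : (∅ : Finset α) ∈ Z) :
    #Z + #(Z.filter fun z => lcompat (L z) (L z) = true) ≤ 2 * #(typeMeets Z L) := by
  classical
  set M := typeMeets Z L with hM
  set S := Z.filter fun z => lcompat (L z) (L z) = true with hS
  -- the choice map
  let e : Finset α → Finset α := fun z => if z ∈ M then z else G \ z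
  have heM : ∀ z ∈ Z, e z ∈ M := by
    intro z hz
    by_cases h : z ∈ M
    · simp only [e, h, if_true]
    · simp only [e, h, if_false]
      exact (mem_or_compl_mem_typeMeets_of_empty_mem hZG hcc hne hflip h0 hz).resolve_left h
  -- S ⊆ M and members of S are fixed by e; every m ∈ M has at most the two preimages m, G \ m
  have hSM : S ⊆ M := fun z hz => mem_typeMeets_of_selfcompat (mem_filter.1 hz).1 (mem_filter.1 hz).2
  -- count: #Z = Σ_{m ∈ M} #(fibre of m) and #(fibre) ≤ 2, with #(fibre) ≤ 1 + [complement not in S] ... we do a direct injection instead: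
  -- Z ⊔ S ↪ M × Bool :  z ∈ Z ↦ (e z, [e z = z]),  s ∈ S ↦ (G \ s, ?) — simpler: split Z into A = {z : z ∈ M} and B = Z \ A.
  set A := Z.filter fun z => z ∈ M with hA
  set B := Z.filter fun z => z ∉ M with hB
  have hZAB : #Z = #A + #B := by
    rw [hA, hB]; exact (card_filter_add_card_filter_not _).symm
  -- A ⊆ M (as sets of sets): #A ≤ #M
  have hAle : #A ≤ #M := card_le_card fun z hz => (mem_filter.1 hz).2
  -- B ↪ M via complement, image disjoint from S (complements of B-members are not self-compatible? no — but they are in M and NOT in B's image twice)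
  have hBinj : Set.InjOn (fun z => G \ z) ↑Z := by
    intro z hz z' hz' h
    have h1 := hZG z (mem_coe.1 hz); have h2 := hZG z' (mem_coe.1 hz')
    have : G \ (G \ z) = G \ (G \ z') := by simp only at h; rw [h]
    rwa [Finset.sdiff_sdiff_eq_self h1, Finset.sdiff_sdiff_eq_self h2] at this
  have hBim : B.image (fun z => G \ z) ⊆ M \ S := by
    intro m hm
    obtain ⟨z, hz, rfl⟩ := mem_image.1 hm
    obtain ⟨hzZ, hzM⟩ := mem_filter.1 hz
    refine mem_sdiff.2 ⟨(mem_or_compl_mem_typeMeets_of_empty_mem hZG hcc hne hflip h0 hzZ).resolve_left hzM, ?_⟩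
    intro hS'
    -- G \ z self-compatible ⇒ z self-compatible ⇒ z ∈ M, contradiction
    have hsc := (mem_filter.1 hS').2
    have hzsc : lcompat (L z) (L z) = true := by
      have := selfcompat_compl hflip (hcc z hzZ) hsc
      rwa [Finset.sdiff_sdiff_eq_self (hZG z hzZ)] at this
    exact hzM (mem_typeMeets_of_selfcompat hzZ hzsc)
  have hBle : #B ≤ #M - #S := by
    calc #B = #(B.image fun z => G \ z) := (card_image_of_injOn (hBinj.mono (coe_subset.2 (filter_subset _ Z)))).symm
      _ ≤ #(M \ S) := card_le_card hBim
      _ = #M - #S := card_sdiff_of_subset hSM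
  have hSle : #S ≤ #M := card_le_card hSM
  omega

end face

end Summit.CriticalPhenomena.PercolationContinuityZ3.Theorems.SahiColouredDaykin
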